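import Literature.Computability.Complexity.ACRealizeOver
import HarnessLib

/-!
# Multi-output constant-depth circuits with sharing: `ACVec`

`ACRealize.lean` builds single-output `AC⁰`-type circuits (`ACReal f d s`: a gate list over
`acBasis` with `≤ s` gates whose output wire has `acWeight`-depth `≤ d`) *formula-style*: the
`∧`/`∨` of a family juxtaposes independent copies of the blocks, so a sub-circuit used `t`
times is paid `t` times. Constructions such as the `AC⁰` kernelization circuits for
`k`-Vertex-Cover / `(n-k)`-Clique (Oliveira–Santhanam 2018; Chen et al. 2020, Prop. 50) need
genuine *sharing*: a layer of intermediate results (e.g. the high-degree indicator of every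
vertex) is computed once and read by many gates of the next layer. This file provides the
multi-output companion of `ACReal` with exactly that composition principle:

* `ACVec f d s` for `f : (ι → Bool) → (κ → Bool)` — one well-formed gate list over `acBasis`
  with `≤ s` gates and output wires `o k` (`k : κ`), each of depth `≤ d`, carrying `f x k`;
* `acVec_ofBlocks` / `acVec_ofBlocks_fintype` — a layer from single-output blocks
  (juxtaposition: sizes add, depth is the max);
* `ACVec.comp` — **composition with sharing**: an outer multi-output realization over the
  outputs of an inner one realizes the composite at depth `d₁ + d` with `s₁ + s` gates (the
  inner list is laid down ONCE and the outer program is relocated behind it, re-wired to the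
  inner output wires: `GateList.vals_append_reloc`, `GateList.wdepths_append_reloc_le`);
* `ACVec.rewire` (renaming input variables), `ACVec.proj` (one output as an `ACReal`),
  `ACVec.outMap`, `mono`, `congr`.

Everything is proved (Vollmer 1999, §1.2: composition of circuits, depth and size add).
Mathlib has no Boolean circuits.

## References

* H. Vollmer, *Introduction to Circuit Complexity* (1999), §1.2.
* S. Arora, B. Barak, *Computational Complexity: A Modern Approach* (2009), Def. 6.1, Rem. 6.4.
-/

namespace Literature.Computability.Complexity

open Finset GateList

variable {ι ι' κ κ' μ : Type*}

/-- `ACVec f d s`: some well-formed gate list over `acBasis` with at most `s` gates has output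
wires `o k` (`k : κ`), each of `acWeight`-depth at most `d`, carrying `f x k` on every input `x`
(a multi-output circuit of depth `d` and size `s` over the unbounded fan-in basis, negations
free; Vollmer 1999, §1.2). For `κ = Unit` this is `ACReal`. [cite: Vollmer1999, §1.2] -/
def ACVec (f : (ι → Bool) → κ → Bool) (d s : ℕ) : Prop :=
  ∃ (gs : List (Gate ι)) (o : κ → ι ⊕ ℕ), WF gs ∧ (∀ g ∈ gs, g.fn ∈ acBasis) ∧
    (∀ k, OutOK gs.length (o k)) ∧ gs.length ≤ s ∧
      (∀ k, wireDepthOf (wdepths acWeight gs) (o k) ≤ d) ∧ ∀ x k, wireOf x (vals gs x) (o k) = f x k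

namespace ACVec

variable {f g : (ι → Bool) → κ → Bool} {d d' s s' : ℕ}

/-- Monotonicity in depth and size. [folklore] -/
theorem mono (h : ACVec f d s) (hd : d ≤ d') (hs : s ≤ s') : ACVec f d' s' := by
  obtain ⟨gs, o, hwf, hB, ho, hl, hdep, hev⟩ := h
  exact ⟨gs, o, hwf, hB, ho, hl.trans hs, fun k => (hdep k).trans hd, hev⟩

/-- Extensionality in the computed map. [folklore] -/
theorem congr (h : ACVec f d s) (hfg : ∀ x k, f x k = g x k) : ACVec g d s := by
  obtain ⟨gs, o, hwf, hB, ho, hl, hdep, hev⟩ := h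
  exact ⟨gs, o, hwf, hB, ho, hl, hdep, fun x k => (hev x k).trans (hfg x k)⟩

/-- Selecting / duplicating / reindexing output wires is free. [folklore] -/
theorem outMap (h : ACVec f d s) (r : κ' → κ) : ACVec (fun x k' => f x (r k')) d s := by
  obtain ⟨gs, o, hwf, hB, ho, hl, hdep, hev⟩ := h
  exact ⟨gs, fun k' => o (r k'), hwf, hB, fun k' => ho _, hl, fun k' => hdep _, fun x k' => hev x _⟩

/-- One output of a multi-output realization, as a single-output realization. [folklore] -/
theorem proj (h : ACVec f d s) (k : κ) : ACReal (fun x => f x k) d s := by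
  obtain ⟨gs, o, hwf, hB, ho, hl, hdep, hev⟩ := h
  exact ⟨gs, o k, hwf, hB, ho k, hl, hdep k, fun x => hev x k⟩

end ACVec

/-- A single-output realization is a one-output `ACVec`. [folklore] -/
theorem ACReal.toVec {f : (ι → Bool) → Bool} {d s : ℕ} (h : ACReal f d s) :
    ACVec (fun x (_ : Unit) => f x) d s := by
  obtain ⟨gs, o, hwf, hB, ho, hl, hdep, hev⟩ := h
  exact ⟨gs, fun _ => o, hwf, hB, fun _ => ho, hl, fun _ => hdep, fun x _ => hev x⟩

/-! ### A layer from single-output blocks -/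

/-- **Juxtaposition of blocks** (Vollmer 1999, §1.2): if each `f j` (`j : Fin M`) is realized at
depth `d` with `s j` gates then the multi-output map `x ↦ (f j x)ⱼ` is realized at depth `d`
with `∑ⱼ s j` gates (lay the blocks side by side; no gate is shared, none is added).
[cite: Vollmer1999, §1.2] -/
theorem acVec_ofBlocks {M : ℕ} {f : Fin M → (ι → Bool) → Bool} {d : ℕ} {s : Fin M → ℕ}
    (h : ∀ j, ACReal (f j) d (s j)) : ACVec (fun x j => f j x) d (∑ j, s j) := by
  choose gs o hwf hB ho hl hdep hev using h
  set bs : List (List (Gate ι) × (ι ⊕ ℕ)) := List.ofFn fun j => (gs j, o j) with hbs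
  have hbs_len : bs.length = M := by simp [hbs]
  have hmem : ∀ b ∈ bs, ∃ j, b = (gs j, o j) := by
    intro b hb
    simp only [hbs, List.mem_ofFn] at hb
    obtain ⟨j, rfl⟩ := hb
    exact ⟨j, rfl⟩
  have hO : ∀ b ∈ bs, OutOK b.1.length b.2 := by
    intro b hb; obtain ⟨j, rfl⟩ := hmem b hb; exact ho j
  have houts_len : (parBlocks bs).2.length = M := by rw [length_parBlocks_snd, hbs_len]
  have hbsk : ∀ j : Fin M, bs[j.1]'(by rw [hbs_len]; exact j.2) = (gs j, o j) := by
    intro j; simp [hbs]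
  refine ⟨(parBlocks bs).1, fun j => (parBlocks bs).2[j.1]'(by rw [houts_len]; exact j.2),
    wf_parBlocks bs fun b hb => ?_, fn_mem_parBlocks bs fun b hb => ?_, fun j => ?_, ?_,
    fun j => ?_, fun x j => ?_⟩
  · obtain ⟨j, rfl⟩ := hmem b hb; exact hwf j
  · obtain ⟨j, rfl⟩ := hmem b hb; exact hB j
  · exact outOK_parBlocks bs hO _ (List.getElem_mem _)
  · rw [length_parBlocks_fst]
    simp only [hbs, List.map_ofFn, List.sum_ofFn, Function.comp_def]
    exact Finset.sum_le_sum fun j _ => hl j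
  · have := wireDepthOf_parBlocks acWeight bs hO j.1 (by rw [houts_len]; exact j.2)
      (by rw [hbs_len]; exact j.2)
    rw [hbsk j] at this
    rw [this]
    exact hdep j
  · have := wireOf_parBlocks x bs hO j.1 (by rw [houts_len]; exact j.2)
      (by rw [hbs_len]; exact j.2)
    rw [hbsk j] at this
    rw [this]
    exact hev j x

/-- Juxtaposition of blocks indexed by a finite type (through an enumeration).
[cite: Vollmer1999, §1.2] -/
theorem acVec_ofBlocks_fintype [Fintype κ] {f : κ → (ι → Bool) → Bool} {d : ℕ} {s : κ → ℕ}
    (h : ∀ k, ACReal (f k) d (s k)) : ACVec (fun x k => f k x) d (∑ k, s k) := by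
  set e := Fintype.equivFin κ
  have h' : ∀ j : Fin (Fintype.card κ), ACReal (f (e.symm j)) d (s (e.symm j)) := fun j => h _
  have hv := acVec_ofBlocks h'
  rw [show (∑ j, s (e.symm j)) = ∑ k, s k from Equiv.sum_comp e.symm s] at hv
  exact (hv.outMap e).congr fun x k => by simp

/-! ### Composition with sharing -/

namespace GateList

/-- Depth of a relocated wire: a wire of the second block, shifted behind the first block and
re-wired along `ρ`, has depth at most its depth in the second block plus a bound `Dm` on the
depths of the wires `ρ i` (given the conclusion of `wdepths_append_reloc_le` for the gates).
[folklore] -/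
theorem wireDepthOf_shiftWire_le {ι' : Type*} {ds ds' base : List ℕ} (ρ : ι' → ι ⊕ ℕ)
    (hρ : WiresOK ds.length ρ) {D Dm : ℕ} (hDm : ∀ i, wireDepthOf ds (ρ i) ≤ Dm)
    (hds' : ∀ m, ds'.getD m 0 ≤ base.getD m 0 + Dm) (w : ι' ⊕ ℕ)
    (hw : wireDepthOf base w ≤ D) :
    wireDepthOf (ds ++ ds') (shiftWire ρ ds.length w) ≤ D + Dm := by
  cases w with
  | inl i =>
    simp only [shiftWire]
    rw [wireDepthOf_append_of_lt _ _ (ρ i) (fun m hm => hρ i m hm)]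
    exact (hDm i).trans (Nat.le_add_left _ _)
  | inr m =>
    simp only [shiftWire, wireDepthOf_inr, List.getD_eq_getElem?_getD]
    rw [List.getElem?_append_right (by omega), Nat.add_sub_cancel]
    have h1 := hds' m
    rw [wireDepthOf_inr] at hw
    rw [List.getD_eq_getElem?_getD, List.getD_eq_getElem?_getD] at h1
    rw [List.getD_eq_getElem?_getD] at hw
    omega

end GateList

/-- **Composition with sharing** (Vollmer 1999, §1.2): if `F : {0,1}^κ → {0,1}^μ` is realized
at depth `d₁` with `s₁` gates and `f : {0,1}^ι → {0,1}^κ` at depth `d` with `s` gates, then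
`x ↦ F (f x)` is realized at depth `d₁ + d` with `s₁ + s` gates: lay down the program of `f`
once and relocate the program of `F` behind it, its input `k` re-wired to the `k`-th output
wire of `f`. Every output of `f` is computed once however often `F` reads it.
[cite: Vollmer1999, §1.2] -/
theorem ACVec.comp {F : (κ → Bool) → μ → Bool} {d₁ s₁ : ℕ} (hF : ACVec F d₁ s₁)
    {f : (ι → Bool) → κ → Bool} {d s : ℕ} (hf : ACVec f d s) :
    ACVec (fun x => F (f x)) (d₁ + d) (s₁ + s) := by
  obtain ⟨gsF, oF, hwfF, hBF, hoF, hlF, hdepF, hevF⟩ := hF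
  obtain ⟨G, ρ, hwfG, hBG, hρ', hlG, hdepG, hevG⟩ := hf
  have hρ : WiresOK G.length ρ := fun j m hm => hρ' j m hm
  obtain ⟨ds', hds', hlen', hle'⟩ := wdepths_append_reloc_le acWeight G gsF ρ hρ d hdepG
  refine ⟨G ++ gsF.map (reloc ρ G.length), fun k => shiftWire ρ G.length (oF k),
    hwfG.append_reloc hwfF hρ, ?_, fun k => ?_, ?_, fun k => ?_, fun x k => ?_⟩
  · intro g' hg'
    rw [List.mem_append, List.mem_map] at hg'
    rcases hg' with hg' | ⟨g₀, hg₀, rfl⟩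
    · exact hBG g' hg'
    · rw [reloc_fn]; exact hBF g₀ hg₀
  · rw [List.length_append, List.length_map]
    exact wiresOK_shiftWire hρ (fun k m hm => hoF k m hm) k
  · rw [List.length_append, List.length_map, add_comm]
    exact Nat.add_le_add hlF hlG
  · rw [hds']
    have hρd : WiresOK (wdepths acWeight G).length ρ := by rw [length_wdepths]; exact hρ
    have := wireDepthOf_shiftWire_le (ds := wdepths acWeight G) ρ hρd hdepG hle' (oF k) (hdepF k)
    rw [length_wdepths] at this
    exact this
  · show wireOf x (vals (G ++ gsF.map (reloc ρ G.length)) x) (shiftWire ρ G.length (oF k)) = _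
    rw [vals_append_reloc G gsF ρ hρ x,
      wireOf_shiftWire x (vals G x) _ (length_vals G x) ρ hρ (oF k)]
    have hx : (fun i => wireOf x (vals G x) (ρ i)) = f x := funext (hevG x)
    rw [hx]
    exact hevF _ k

/-- Composition of a single-output outer realization with a shared inner layer.
[cite: Vollmer1999, §1.2] -/
theorem ACReal.compVec {F : (κ → Bool) → Bool} {d₁ s₁ : ℕ} (hF : ACReal F d₁ s₁)
    {f : (ι → Bool) → κ → Bool} {d s : ℕ} (hf : ACVec f d s) :
    ACReal (fun x => F (f x)) (d₁ + d) (s₁ + s) :=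
  (hF.toVec.comp hf).proj ()

/-! ### Renaming input variables -/

/-- The re-indexing layer `y ↦ (y (e i))ᵢ` costs nothing: no gates, depth `0` (its output
wires are input wires). [folklore] -/
theorem acVec_reindex (e : ι → ι') : ACVec (fun (y : ι' → Bool) i => y (e i)) 0 0 :=
  ⟨[], fun i => Sum.inl (e i), WF.nil, (by simp), (fun _ _ h => by cases h), le_rfl,
    (fun _ => by simp), fun _ _ => rfl⟩

/-- **Renaming the inputs** of a realization along `e : ι → ι'`: the same program with input
wire `i` replaced by `e i` realizes `y ↦ f (y ∘ e)` at the same depth and size.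
[cite: Vollmer1999, §1.2] -/
theorem ACVec.rewire {f : (ι → Bool) → κ → Bool} {d s : ℕ} (h : ACVec f d s) (e : ι → ι') :
    ACVec (fun y : ι' → Bool => f (fun i => y (e i))) d s := by
  simpa using h.comp (acVec_reindex e)

/-- Renaming the inputs of a single-output realization. [cite: Vollmer1999, §1.2] -/
theorem ACReal.rewire {f : (ι → Bool) → Bool} {d s : ℕ} (h : ACReal f d s) (e : ι → ι') :
    ACReal (fun y : ι' → Bool => f (fun i => y (e i))) d s :=
  (h.toVec.rewire e).proj ()

end Literature.Computability.Complexity
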